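import Summits.KontsevichZagierPeriods.KontsevichZagierPeriods.Theorems.SymplecticScissorsRealOnePeriodRelationsLoopLayerArcsOval
import Summits.KontsevichZagierPeriods.KontsevichZagierPeriods.Theorems.SymplecticScissorsRealOnePeriodRelationsStubPolyArcs
import Summits.KontsevichZagierPeriods.KontsevichZagierPeriods.Theorems.SymplecticScissorsRealOnePeriodRelationsStubBranchForm
import Summits.KontsevichZagierPeriods.KontsevichZagierPeriods.Theorems.SymplecticScissorsRealOnePeriodRelationsStubBranchPath
import Summits.KontsevichZagierPeriods.KontsevichZagierPeriods.Theorems.SymplecticScissorsRealOnePeriodRelationsStubBranchRealise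

/-!
# Crux `RealOnePeriodRelations` (stmt-KontsevichZagierPeriods-10042), line `nash-retraction-thin-strip`, reshape 5
# (the unconditional LOOP layer): ARCS, part 2 — the branch arc and stub `stub_loopArcs`

A branch cell `[∫_{(e,∞)} c₀/√f]` on `E_{A,B}` (`e` the LARGEST real root of `f = x³ + Ax + B`) is a complete integral over
the unbounded real branch, which closes up only through the point at infinity.  Translating the branch by ANOTHER
`2`-torsion point `(c, 0)` (`c` a second root of `f`, real or complex) gives a CLOSED `C¹` loop inside the affine curve
(`stub_branchPath`), and along the translate `dx′/y′ = dx/y` pointwise, so the period integrand of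
`(E_{A,B}, c₀ dx/y, branch + (c,0))` (`c₀ dx/y` in the complex Bézout normal form `stub_branchForm`) is `c₀ x′(t)/y(t)`,
real on both halves; rule 2 along the halves is `stub_branchRealise`.  Hence `stub_branchArc`, and with `stub_polyArcs` (polynomial
cells = multiples of the unit symbol) and `stub_ovalArc` the registered `stub_loopArcs`.
[cite: HuberWustholz2022, §3.3.1 and §13.2] [cite: KontsevichZagier2001, §1.2]
-/

noncomputable section

open scoped BigOperators Polynomial
open Set MeasureTheory MvPolynomial
open Literature.NumberTheory.Transcendental Literature.NumberTheory.Transcendental.CurvePeriods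
open Summit.KontsevichZagierPeriods.SymplecticScissors.RealOnePeriodRelationsNegative (M₁ H₁ crux_iff unitDom)

namespace Summit.KontsevichZagierPeriods.SymplecticScissors.RealOnePeriodRelations

namespace LoopLayer

/-- **Stub `stub_branchArc`** (registered, lead) — THE BRANCH ARC. A branch cell `[∫_{(e,∞)} c₀/√f]` on `E_{A,B}` (`e` the largest real root) is, modulo `M₁`, the
real realisation of HALF the closed translated-branch symbol `(E_{A,B}, c₀ dx/y, branch + (c, 0))`, with the same value:
along the translate by the `2`-torsion point `(c, 0)` one has `dx′/y′ = dx/y`, so the period integrand is `c₀ x′(t)/y(t)`.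
[cite: HuberWustholz2022, §3.3.1 and §13.2] -/
theorem stub_branchArc : ∀ (A B : ℝ), IsAlgebraic ℚ A → IsAlgebraic ℚ B → 4 * A ^ 3 + 27 * B ^ 2 ≠ 0 →
    ∀ (ρ : KZ.IntegralRep 1) {e c₀ : ℝ}, IsAlgebraic ℚ e → IsAlgebraic ℚ c₀ → e ^ 3 + A * e + B = 0 →
    (∀ x : ℝ, e < x → 0 < x ^ 3 + A * x + B) → ρ.domain = {z | e < z 0} →
    (∀ z ∈ ρ.domain, ρ.integrand z = c₀ / Real.sqrt ((z 0) ^ 3 + A * (z 0) + B)) →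
    ∃ (C : PeriodSymbol →₀ ℂ) (R : PeriodSymbol → KZ.IntegralRep 1), (∀ s, IsAlgebraic ℚ (C s)) ∧
      (∀ s ∈ C.support, s.Z = weierCurve (A : ℂ) (B : ℂ) ∧ s.γ.toFun 1 = s.γ.toFun 0) ∧
      (∀ s ∈ C.support, IsSemialgebraicMapOn ℚ {z : Fin 1 → ℝ | z 0 ∈ Set.Icc (0 : ℝ) 1}
        (fun z => Fin.append (fun i => (s.γ.toFun (z 0) i).re) (fun i => (s.γ.toFun (z 0) i).im))) ∧
      (∀ s ∈ C.support, (R s).domain = {z | z 0 ∈ Set.Ioo (0 : ℝ) 1} ∧ ∀ z ∈ (R s).domain, (R s).integrand z =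
        (C s * ∑ i, MvPolynomial.eval (s.γ.toFun (z 0)) (s.ω i) * deriv (fun u => s.γ.toFun u i) (z 0)).re) ∧
      evalCombination C = ((ρ.value : ℝ) : ℂ) ∧ KZ.of ρ - ∑ s ∈ C.support, KZ.of (R s) ∈ M₁ := by
  classical
  intro A B hA hB hD ρ e c₀ he hc₀ hfe hpos hdom hint
  obtain ⟨c, γ, hfc, hF, hxc, hcl, hγ₁, hγ₂, hSA⟩ := stub_branchPath A B e hA hB he hD hfe hpos
  obtain ⟨G, H, hG, hH, hGH⟩ := stub_branchForm A B c₀ hA hB hc₀ hD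
  have hA' : IsAlgebraic ℚ (A : ℂ) := hA.algebraMap
  have hB' : IsAlgebraic ℚ (B : ℂ) := hB.algebraMap
  have hD' : Weier.disc (A : ℂ) (B : ℂ) ≠ 0 := by
    unfold Weier.disc
    exact_mod_cast hD
  have hω : ∀ i, HasAlgCoeffs ((![G, H] : Fin 2 → MvPolynomial (Fin 2) ℂ) i) := by
    intro i
    fin_cases i
    · exact hG
    · exact hH
  set sy : PeriodSymbol := ⟨weierCurve (A : ℂ) (B : ℂ), Weier.isSmoothAffineCurve (A : ℂ) (B : ℂ) hA' hB' hD',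
    ![G, H], hω, γ⟩ with hsy
  have hhalf : IsAlgebraic ℚ (1 / 2 : ℂ) := by
    rw [one_div]; exact (isAlgebraic_nat 2).inv
  obtain ⟨R₁, hR₁dom, hR₁⟩ := stub_realises sy.Z sy.γ hSA sy.ω sy.ω_algebraic (1 / 2) hhalf
  -- notation
  set F : ℂ := 3 * c ^ 2 + (A : ℂ) with hFdef
  set x : ℝ → ℝ := fun u => e + (u * (1 - u)) ^ 2 / (u - 1 / 2) ^ 2 with hx
  set xd : ℝ → ℝ := fun u => u * (1 - u) * (1 - 2 * u) * (u ^ 2 - u + 1 / 2) / (u - 1 / 2) ^ 4 with hxd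
  set f : ℝ → ℝ := fun v => v ^ 3 + A * v + B with hf
  -- the period integrand on the two open halves: `Σ = c₀ x′/y` with `y = √f(x)/σ`
  have key : ∀ t ∈ Set.Ioo (0 : ℝ) 1, t ≠ 1 / 2 → ∀ (σ : ℝ), (σ = 1 ∨ σ = -1) →
      (∀ᶠ u in nhds t, γ.toFun u = ![c + F / (((x u : ℝ) : ℂ) - c),
        -((σ : ℝ) : ℂ) * F * ((Real.sqrt (f (x u)) : ℝ) : ℂ) / (((x u : ℝ) : ℂ) - c) ^ 2]) →
      (∑ i, MvPolynomial.eval (sy.γ.toFun t) (sy.ω i) * deriv (fun u => sy.γ.toFun u i) t) =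
        ((ρ.integrand (fun _ => x t) * (σ * xd t) : ℝ) : ℂ) := by
    intro t ht ht2 σ hσ hloc
    have hxe : e < x t := branchChart_gt e ht ht2
    have hfpos : 0 < f (x t) := hpos _ hxe
    set y : ℝ := Real.sqrt (f (x t)) with hy
    have hy0 : 0 < y := Real.sqrt_pos.2 hfpos
    have hyC : (y : ℂ) ≠ 0 := by exact_mod_cast hy0.ne'
    have hσC : (σ : ℂ) ≠ 0 := by rcases hσ with rfl | rfl <;> norm_num
    have hσ2 : (σ : ℂ) ^ 2 = 1 := by rcases hσ with rfl | rfl <;> norm_num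
    have hxcC : ((x t : ℝ) : ℂ) - c ≠ 0 := sub_ne_zero.2 (hxc t ht ht2)
    -- the point and the derivatives of the coordinates
    have hPt : γ.toFun t = ![c + F / (((x t : ℝ) : ℂ) - c),
        -((σ : ℝ) : ℂ) * F * ((y : ℝ) : ℂ) / (((x t : ℝ) : ℂ) - c) ^ 2] := hloc.self_of_nhds
    have hxC : HasDerivAt (fun u => ((x u : ℝ) : ℂ)) ((xd t : ℝ) : ℂ) t :=
      (hasDerivAt_branchChart e ht2).ofReal_comp
    have hXf : HasDerivAt (fun u => c + F / (((x u : ℝ) : ℂ) - c))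
        ((0 * (((x t : ℝ) : ℂ) - c) - F * ((xd t : ℝ) : ℂ)) / (((x t : ℝ) : ℂ) - c) ^ 2) t :=
      ((hasDerivAt_const t F).div (hxC.sub_const c) hxcC).const_add c
    have hX : HasDerivAt (fun u => γ.toFun u 0)
        ((0 * (((x t : ℝ) : ℂ) - c) - F * ((xd t : ℝ) : ℂ)) / (((x t : ℝ) : ℂ) - c) ^ 2) t :=
      hXf.congr_of_eventuallyEq (hloc.mono fun u hu => show γ.toFun u 0 = _ by rw [hu]; rfl)
    have hY : HasDerivAt (fun u => γ.toFun u 1) (deriv (fun u => γ.toFun u 1) t) t := γ.hasDerivAt ht 1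
    -- the curve equation along `γ`, differentiated
    have hcurve : ∀ᶠ u in nhds t, (γ.toFun u 1) ^ 2 = (γ.toFun u 0) ^ 3 + (A : ℂ) * γ.toFun u 0 + B := by
      filter_upwards [Ioo_mem_nhds ht.1 ht.2] with u hu
      have h := γ.mem_points u (Ioo_subset_Icc_self hu)
      rw [Weier.mem_points_iff, Weier.eval_fPoly] at h
      exact h
    have hder := two_mul_deriv_of_sq_eq hcurve hX hY
    have hcurve_t : (γ.toFun t 1) ^ 2 = (γ.toFun t 0) ^ 3 + (A : ℂ) * γ.toFun t 0 + B := hcurve.self_of_nhds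
    have hY0 : γ.toFun t 1 ≠ 0 := by
      rw [hPt]
      show -((σ : ℝ) : ℂ) * F * ((y : ℝ) : ℂ) / (((x t : ℝ) : ℂ) - c) ^ 2 ≠ 0
      exact div_ne_zero (mul_ne_zero (mul_ne_zero (neg_ne_zero.2 hσC) hF) hyC) (pow_ne_zero 2 hxcC)
    have hform := hGH (γ.toFun t 0) (γ.toFun t 1) hcurve_t hY0
    -- `Σ = G X′ + H Y′ = c₀ X′ / Y`
    have hSum : (∑ i, MvPolynomial.eval (sy.γ.toFun t) (sy.ω i) * deriv (fun u => sy.γ.toFun u i) t) =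
        (c₀ : ℂ) * ((0 * (((x t : ℝ) : ℂ) - c) - F * ((xd t : ℝ) : ℂ)) / (((x t : ℝ) : ℂ) - c) ^ 2) / γ.toFun t 1 := by
      show (∑ i, MvPolynomial.eval (γ.toFun t) ((![G, H] : Fin 2 → MvPolynomial (Fin 2) ℂ) i) *
          deriv (fun u => γ.toFun u i) t) = _
      rw [Fin.sum_univ_two, hX.deriv]
      simp only [Matrix.cons_val_zero, Matrix.cons_val_one]
      have hev : (![γ.toFun t 0, γ.toFun t 1] : Fin 2 → ℂ) = γ.toFun t := by
        funext i; fin_cases i <;> rfl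
      rw [hev] at hform
      set X' := (0 * (((x t : ℝ) : ℂ) - c) - F * ((xd t : ℝ) : ℂ)) / (((x t : ℝ) : ℂ) - c) ^ 2
      set Y' := deriv (fun u => γ.toFun u 1) t
      have hG' : MvPolynomial.eval (γ.toFun t) G =
          (c₀ : ℂ) / γ.toFun t 1 - MvPolynomial.eval (γ.toFun t) H * ((3 * γ.toFun t 0 ^ 2 + (A : ℂ)) / (2 * γ.toFun t 1)) := by
        rw [← hform]; ring
      rw [hG']
      field_simp
      linear_combination (MvPolynomial.eval (γ.toFun t) H) * hder
    rw [hSum, hPt]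
    simp only [Matrix.cons_val_one]
    -- `c₀ X′/Y = c₀ σ x′/√f(x)`
    have hρ : ρ.integrand (fun _ => x t) = c₀ / y := by
      have hz : (fun _ : Fin 1 => x t) ∈ ρ.domain := by rw [hdom]; exact hxe
      rw [hint _ hz]
    rw [hρ]
    push_cast
    field_simp
    linear_combination (-(c₀ : ℂ) * ((xd t : ℝ) : ℂ) * (3 * c ^ 2 + (A : ℂ))) * hσ2
  -- the realisation integrand on the two halves
  have hloc₁ : ∀ t ∈ Set.Ioo (0 : ℝ) (1 / 2), ∀ᶠ u in nhds t, γ.toFun u = ![c + F / (((x u : ℝ) : ℂ) - c),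
      -(((1 : ℝ) : ℝ) : ℂ) * F * ((Real.sqrt (f (x u)) : ℝ) : ℂ) / (((x u : ℝ) : ℂ) - c) ^ 2] := by
    intro t ht
    filter_upwards [Ioo_mem_nhds ht.1 ht.2] with u hu
    rw [hγ₁ u hu]
    have e1 : -(((1 : ℝ) : ℝ) : ℂ) * F = -F := by push_cast; ring
    rw [e1]
  have hloc₂ : ∀ t ∈ Set.Ioo (1 / 2 : ℝ) 1, ∀ᶠ u in nhds t, γ.toFun u = ![c + F / (((x u : ℝ) : ℂ) - c),
      -(((-1 : ℝ) : ℝ) : ℂ) * F * ((Real.sqrt (f (x u)) : ℝ) : ℂ) / (((x u : ℝ) : ℂ) - c) ^ 2] := by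
    intro t ht
    filter_upwards [Ioo_mem_nhds ht.1 ht.2] with u hu
    rw [hγ₂ u hu]
    have e2 : -(((-1 : ℝ) : ℝ) : ℂ) * F = F := by push_cast; ring
    rw [e2]
  have hR₁' : ∀ t ∈ Set.Ioo (0 : ℝ) (1 / 2), R₁.integrand (fun _ => t) =
      1 / 2 * (ρ.integrand (fun _ => x t) * xd t) := by
    intro t ht
    have ht' : t ∈ Set.Ioo (0 : ℝ) 1 := ⟨ht.1, ht.2.trans (by norm_num)⟩
    have hz : (fun _ : Fin 1 => t) ∈ R₁.domain := by rw [hR₁dom]; exact ht'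
    rw [hR₁ _ hz]
    show ((1 / 2 : ℂ) * ∑ i, MvPolynomial.eval (sy.γ.toFun t) (sy.ω i) * deriv (fun u => sy.γ.toFun u i) t).re = _
    rw [key t ht' ht.2.ne 1 (Or.inl rfl) (hloc₁ t ht), one_mul]
    simp only [Complex.mul_re, Complex.ofReal_re, Complex.ofReal_im, mul_zero, sub_zero]
    norm_num
  have hR₂' : ∀ t ∈ Set.Ioo (1 / 2 : ℝ) 1, R₁.integrand (fun _ => t) =
      1 / 2 * (ρ.integrand (fun _ => x t) * -xd t) := by
    intro t ht
    have ht' : t ∈ Set.Ioo (0 : ℝ) 1 := ⟨(by norm_num : (0:ℝ) < 1 / 2).trans ht.1, ht.2⟩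
    have hz : (fun _ : Fin 1 => t) ∈ R₁.domain := by rw [hR₁dom]; exact ht'
    rw [hR₁ _ hz]
    show ((1 / 2 : ℂ) * ∑ i, MvPolynomial.eval (sy.γ.toFun t) (sy.ω i) * deriv (fun u => sy.γ.toFun u i) t).re = _
    rw [key t ht' ht.1.ne' (-1) (Or.inr rfl) (hloc₂ t ht), neg_one_mul]
    simp only [Complex.mul_re, Complex.ofReal_re, Complex.ofReal_im, mul_zero, sub_zero]
    norm_num
  have hsub : KZ.of ρ - KZ.of R₁ ∈ M₁ := stub_branchRealise e he ρ R₁ hdom hR₁dom hR₁' hR₂'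
  -- the value
  have hval : R₁.value = ρ.value := by
    have h := Summit.KontsevichZagierPeriods.SymplecticScissors.RealOnePeriodRelationsNegative.eval_eq_zero_of_mem_M₁ hsub
    rw [map_sub, KZ.eval_of, KZ.eval_of, sub_eq_zero] at h
    exact h.symm
  have hper : (1 / 2 : ℂ) * sy.period = ((R₁.value : ℝ) : ℂ) := by
    refine half_period_eq_value sy R₁ hR₁dom hR₁ (fun t => if t < 1 / 2 then ρ.integrand (fun _ => x t) * xd t
      else ρ.integrand (fun _ => x t) * -xd t) (fun t ht ht2 => ?_)
    rcases lt_or_gt_of_ne ht2 with h | h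
    · rw [if_pos h, key t ht ht2 1 (Or.inl rfl) (hloc₁ t ⟨ht.1, h⟩), one_mul]
    · rw [if_neg (not_lt.2 h.le), key t ht ht2 (-1) (Or.inr rfl) (hloc₂ t ⟨h, ht.2⟩), neg_one_mul]
  refine ⟨Finsupp.single sy (1 / 2), fun _ => R₁, ?_, ?_, ?_, ?_, ?_, ?_⟩
  · intro t
    by_cases h : t = sy
    · subst h; simpa using hhalf
    · rw [Finsupp.single_apply, if_neg (Ne.symm h)]; exact isAlgebraic_zero
  · intro t ht
    rw [Finsupp.support_single _ (by norm_num), Finset.mem_singleton] at ht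
    subst ht
    exact ⟨rfl, hcl⟩
  · intro t ht
    rw [Finsupp.support_single _ (by norm_num), Finset.mem_singleton] at ht
    subst ht
    exact hSA
  · intro t ht
    rw [Finsupp.support_single _ (by norm_num), Finset.mem_singleton] at ht
    subst ht
    refine ⟨hR₁dom, fun z hz => ?_⟩
    rw [hR₁ z hz, Finsupp.single_eq_same]
  · rw [evalCombination_single, hper, hval]
  · rw [Finsupp.support_single _ (by norm_num), Finset.sum_singleton]
    exact hsub

/-- **Stub `stub_loopArcs`** (registered, lead) — ARCS of the loop layer: a polynomial cell is realised by a multiple of the unit symbol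
(`stub_polyArcs`), an odd oval cell by HALF the oval loop symbol `(E_{A,B}, (P₂ y + P₃/y) dx, oval)` (`stub_ovalPath`,
`stub_ellForm`, `stub_ovalRealise`), a branch cell by HALF the translated branch loop `(E_{A,B}, c₀ dx/y, branch + (c,0))`
(`stub_branchPath`, `stub_branchForm`, `stub_branchRealise`): along the translate `dx′/y′ = dx/y`, so the realisation
integrand is `½ c₀ x′(t)/y(t)` = `½ c₀ |x′(t)|/√f(x(t))` on both halves. [cite: HuberWustholz2022, §3.3.1 and §13.2] -/
theorem stub_loopArcs : ∀ (k : ℕ) (A B : Fin k → ℝ), (∀ j, IsAlgebraic ℚ (A j)) → (∀ j, IsAlgebraic ℚ (B j)) →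
    (∀ j, 4 * A j ^ 3 + 27 * B j ^ 2 ≠ 0) →
    ∀ ρ : KZ.IntegralRep 1,
    ((∃ a b : ℝ, IsAlgebraic ℚ a ∧ IsAlgebraic ℚ b ∧ a < b ∧ ρ.domain = {z | z 0 ∈ Set.Ioo a b} ∧
            ∃ P : Polynomial (algebraicClosure ℚ ℝ), ∀ x ∈ Set.Ioo a b, ρ.integrand (fun _ => x) = Polynomial.aeval x P) ∨
        (∃ j, ∃ e₁ e₂ : ℝ, IsAlgebraic ℚ e₁ ∧ IsAlgebraic ℚ e₂ ∧ e₁ < e₂ ∧ e₁ ^ 3 + A j * e₁ + B j = 0 ∧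
          e₂ ^ 3 + A j * e₂ + B j = 0 ∧ (∀ x ∈ Set.Ioo e₁ e₂, 0 < x ^ 3 + A j * x + B j) ∧
          ρ.domain = {z | z 0 ∈ Set.Ioo e₁ e₂} ∧
          ∃ P₂ P₃ : Polynomial (algebraicClosure ℚ ℝ), ∀ x ∈ Set.Ioo e₁ e₂,
            ρ.integrand (fun _ => x) = Polynomial.aeval x P₂ * Real.sqrt (x ^ 3 + A j * x + B j) +
              Polynomial.aeval x P₃ / Real.sqrt (x ^ 3 + A j * x + B j)) ∨
        (∃ j, ∃ e c₀ : ℝ, IsAlgebraic ℚ e ∧ IsAlgebraic ℚ c₀ ∧ e ^ 3 + A j * e + B j = 0 ∧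
          (∀ x : ℝ, e < x → 0 < x ^ 3 + A j * x + B j) ∧ ρ.domain = {z | e < z 0} ∧
          ∀ z ∈ ρ.domain, ρ.integrand z = c₀ / Real.sqrt ((z 0) ^ 3 + A j * (z 0) + B j))) →
    ∃ (C : PeriodSymbol →₀ ℂ) (R : PeriodSymbol → KZ.IntegralRep 1), (∀ s, IsAlgebraic ℚ (C s)) ∧
      (∀ s ∈ C.support, s = PeriodSymbol.unit ∨
        ∃ j, s.Z = weierCurve (A j : ℂ) (B j : ℂ) ∧ s.γ.toFun 1 = s.γ.toFun 0) ∧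
      (∀ s ∈ C.support, IsSemialgebraicMapOn ℚ {z : Fin 1 → ℝ | z 0 ∈ Set.Icc (0 : ℝ) 1}
        (fun z => Fin.append (fun i => (s.γ.toFun (z 0) i).re) (fun i => (s.γ.toFun (z 0) i).im))) ∧
      (∀ s ∈ C.support, (R s).domain = {z | z 0 ∈ Set.Ioo (0 : ℝ) 1} ∧ ∀ z ∈ (R s).domain, (R s).integrand z =
        (C s * ∑ i, MvPolynomial.eval (s.γ.toFun (z 0)) (s.ω i) * deriv (fun u => s.γ.toFun u i) (z 0)).re) ∧
      evalCombination C = ((ρ.value : ℝ) : ℂ) ∧ KZ.of ρ - ∑ s ∈ C.support, KZ.of (R s) ∈ M₁ := by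
  intro k A B hA hB hD ρ hρ
  rcases hρ with ⟨a, b, ha, hb, hab, hdom, P, hint⟩ |
    ⟨j, e₁, e₂, he₁, he₂, hlt, hf₁, hf₂, hpos, hdom, P₂, P₃, hint⟩ | ⟨j, e, c₀, he, hc₀, hfe, hpos, hdom, hint⟩
  · obtain ⟨C, R, h1, h2, h3, h4, h5, h6⟩ := stub_polyArcs a b ha hb hab P ρ hdom hint
    exact ⟨C, R, h1, fun s hs => Or.inl (h2 s hs), h3, h4, h5, h6⟩
  · obtain ⟨C, R, h1, h2, h3, h4, h5, h6⟩ :=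
      stub_ovalArc (A j) (B j) (hA j) (hB j) (hD j) ρ he₁ he₂ hlt hf₁ hf₂ hpos hdom P₂ P₃ hint
    exact ⟨C, R, h1, fun s hs => Or.inr ⟨j, h2 s hs⟩, h3, h4, h5, h6⟩
  · obtain ⟨C, R, h1, h2, h3, h4, h5, h6⟩ :=
      stub_branchArc (A j) (B j) (hA j) (hB j) (hD j) ρ he hc₀ hfe hpos hdom hint
    exact ⟨C, R, h1, fun s hs => Or.inr ⟨j, h2 s hs⟩, h3, h4, h5, h6⟩

end LoopLayer

end Summit.KontsevichZagierPeriods.SymplecticScissors.RealOnePeriodRelations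

end
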